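import Summits.CriticalPhenomena.PercolationContinuityZ3.Theorems.Transplant.D10SKc11_2555P2
import HarnessLib

/-!
# Diamond film `D_10` — KERNEL CERTIFICATE for the class `11_2555` of `ShapedLinkageX 4 (DiamondFilm.sqShadow (k := 10))`, THE CLASS (mask + coverage from the 2 parts) (template `fullmcp`, |W| = 205, 2256 terminal pairs, 6971 plans)

builds on p205010 (kernel theorem, internal audit signed; external expert review pending) — NOT used in this file.  Lane `prim-bschramm`, seat `prim-bschramm-p2` (gen 43; class C1b;
memo `HOME/bschramm/P2-LATTICES.md` §152); helper file (`--supports stmt-CriticalPhenomena-4575 --as helper`).  Generated by `cert/emit_dk.py` from the plans of `cert/gen_dk.py`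
(canonical BFS routings with avoid hints, exact mirror `cert/kern_dk.py` of «DkSKDefs»); re-checked here by the kernel (`DCtx.checkEs`); `caseOK_k10_11_2555` feeds «D10SKFinal».
[cite: DuminilCopinSidoraviciusTassion2016, §2.3 (proof of Fact 2: the three disjoint paths in B_R(z))]
-/

namespace Summit.CriticalPhenomena.PercolationContinuityZ3.Theorems.Transplant

namespace DiamondFilm.DK

/-- The cleared mask of the class `11_2555` of `D_10` is admissible (inside the cleared block, containing the forced core). [folklore] -/
theorem wOK_k10_11_2555 : DCtx.wOK (⟨10, 1, 1, 2, 5, 5, 5, 81999835198937170517730300462231737225911172755897996829006794644064287301763393273234954364164193615217239026815387811840⟩ : DCtx) = true := by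
  decide +kernel

/-- **THE CLASS `11_2555` OF `D_10` IS COVERED**: every needed bit of every certified terminal pair has a swap-pair plan. [cite: DuminilCopinSidoraviciusTassion2016, §2.3 (proof of Fact 2)] -/
theorem caseOK_k10_11_2555 : CaseOK (⟨10, 1, 1, 2, 5, 5, 5, 81999835198937170517730300462231737225911172755897996829006794644064287301763393273234954364164193615217239026815387811840⟩ : DCtx) :=
  caseOK_of_chunks _ [[14, 15, 16], [17, 18, 19], [20, 25, 33], [37, 45, 49], [57, 61, 69], [73, 81, 85], [93, 158, 159], [160, 161, 162], [163, 164, 169], [177, 181, 189], [193, 201, 205], [213, 217, 225], [229, 237, 302], [304, 306, 308], [326, 332, 350], [356, 374, 380]]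
    (List.forall_mem_cons.2 ⟨checkEs_sound _ _ _ chunk_k10_11_2555_0, List.forall_mem_cons.2 ⟨checkEs_sound _ _ _ chunk_k10_11_2555_1, List.forall_mem_cons.2 ⟨checkEs_sound _ _ _ chunk_k10_11_2555_2, List.forall_mem_cons.2 ⟨checkEs_sound _ _ _ chunk_k10_11_2555_3, List.forall_mem_cons.2 ⟨checkEs_sound _ _ _ chunk_k10_11_2555_4, List.forall_mem_cons.2 ⟨checkEs_sound _ _ _ chunk_k10_11_2555_5, List.forall_mem_cons.2 ⟨checkEs_sound _ _ _ chunk_k10_11_2555_6, List.forall_mem_cons.2 ⟨checkEs_sound _ _ _ chunk_k10_11_2555_7, List.forall_mem_cons.2 ⟨checkEs_sound _ _ _ chunk_k10_11_2555_8, List.forall_mem_cons.2 ⟨checkEs_sound _ _ _ chunk_k10_11_2555_9, List.forall_mem_cons.2 ⟨checkEs_sound _ _ _ chunk_k10_11_2555_10, List.forall_mem_cons.2 ⟨checkEs_sound _ _ _ chunk_k10_11_2555_11, List.forall_mem_cons.2 ⟨checkEs_sound _ _ _ chunk_k10_11_2555_12, List.forall_mem_cons.2 ⟨checkEs_sound _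 _ _ chunk_k10_11_2555_13, List.forall_mem_cons.2 ⟨checkEs_sound _ _ _ chunk_k10_11_2555_14, List.forall_mem_cons.2 ⟨checkEs_sound _ _ _ chunk_k10_11_2555_15, List.forall_mem_nil _⟩⟩⟩⟩⟩⟩⟩⟩⟩⟩⟩⟩⟩⟩⟩⟩)
    (by decide +kernel)

end DiamondFilm.DK

end Summit.CriticalPhenomena.PercolationContinuityZ3.Theorems.Transplant
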